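import Mathlib.Analysis.InnerProductSpace.Calculus
import Mathlib.Analysis.Normed.Module.Connected
import Mathlib.AlgebraicTopology.FundamentalGroupoid.SimplyConnected
import Mathlib.LinearAlgebra.QuadraticForm.Signature
import Literature.Topology.FourManifolds.ClosedBallSmoothMaps
import Literature.Topology.FourManifolds.MorseProofs
import Literature.Topology.FourManifolds.Trisections
import Literature.Topology.FourManifolds.SmoothOrientationProofs
import HarnessLib

/-!
# The closed ball `𝔻ⁿ⁺¹` is a `0`-handle: the Morse function `‖x‖²`

Topic `Literature/Topology/FourManifolds`; companion to `ClosedBall.lean` (the closed unit ball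
`𝔻ⁿ⁺¹ ⊆ ℝⁿ⁺¹` as a compact smooth manifold with boundary, model `𝓡∂ (n + 1)`), `Morse.lean`
(`Literature.Topology.FourManifolds.IsMorse`, `Literature.Topology.FourManifolds.IsMorseAdapted`, `Literature.Topology.FourManifolds.mhessian`, `Literature.Topology.FourManifolds.morseIndex`,
`Literature.Topology.FourManifolds.criticalSetOfIndex`) and `Handles.lean` (`Literature.Topology.FourManifolds.HasHandleDecomposition`,
`Literature.Topology.FourManifolds.IsHandlebodyOfIndexLE`). Everything here is **proved**; the file serves the non-vacuity of
the handlebody vocabulary (`HasHandleDecomposition 2 H (handleCount 1 g)` in `Literature.Topology.FourManifolds.IsGKTrisection`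
(iii), `Trisections.lean`, and in the Heegaard-splitting decomposition of the Lickorish–Wallace
fact `Literature.Topology.FourManifolds.exists_isIntegralSurgeryLink`, `LickorishWallace.lean`): the simplest handlebody,
the ball, really is one in the library's Morse-theoretic sense.

## Main results

* `Literature.ballHeight n : 𝔻ⁿ⁺¹ → ℝ`, `x ↦ ‖x‖²`, and `Literature.ballCenter n` (the origin).
* `Literature.Topology.FourManifolds.isMCriticalPt_ballHeight_iff`: the only critical point of `‖x‖²` on `𝔻ⁿ⁺¹` — boundary
  points included, where the derivative is taken within the half-space in the boundary charts of
  `ClosedBall.lean` — is the centre.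
* `Literature.Topology.FourManifolds.mhessian_ballHeight_ballCenter`: the Hessian at the centre is `2 ⟨·, ·⟩`; hence
  `Literature.Topology.FourManifolds.nondegenerate_mhessian_ballHeight_ballCenter` and `Literature.Topology.FourManifolds.morseIndex_ballHeight_ballCenter`
  (index `0`).
* `Literature.Topology.FourManifolds.isMorse_ballHeight`, `Literature.Topology.FourManifolds.isMorseAdapted_ballHeight`: `‖x‖²` is a Morse function equal to
  `1` and regular on `∂𝔻ⁿ⁺¹ = 𝕊ⁿ` and `< 1` inside (Milnor, *Lectures on the h-cobordism
  theorem* (1965), Def. 3.1 with `V₀ = ∅`).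
* `Literature.hasHandleDecomposition_closedBall : HasHandleDecomposition n 𝔻ⁿ⁺¹ (handleCount 1 0)` —
  **the closed ball is a single `0`-handle** (Milnor, *Morse theory* (1963), §3, Thm. 3.1: the
  sublevel set below the first critical value is a disc) — and
  `Literature.Topology.FourManifolds.isHandlebodyOfIndexLE_closedBall`.
* `Literature.Topology.FourManifolds.connectedSpace_closedBall`, `Literature.Topology.FourManifolds.isOrientable_closedBall` (convexity; Mathlib's
  `contractibleSpace_closedBall` and `Literature.Topology.FourManifolds.isOrientable_of_simplyConnectedSpace_holds`).

## Proof sketch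

In the interior chart of `ClosedBall.lean` (the translation `x ↦ x + 2e₀`) the height function
reads `w ↦ ‖w - 2e₀‖²` near every point of the chart target, so its coordinate derivative at
`w` is `2⟨w - 2e₀, ·⟩` (`hasStrictFDerivAt_norm_sq`), vanishing exactly at `w = 2e₀`, i.e. at the
centre, where the second coordinate derivative is `2⟨·, ·⟩`: positive definite, so nondegenerate
with negative index of inertia `sigNeg = 0`. In the boundary chart at `y ∈ 𝕊ⁿ` (polar
coordinates `x ↦ (1 - ‖x‖, σ(x/‖x‖))`) the height function reads `w ↦ (1 - w₀)²` on the slab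
`{0 ≤ w₀ ≤ 1}` of the half-space, whose derivative within the half-space at the image point
(`w₀ = 0`) is `-2 dw₀ ≠ 0`: boundary points are regular. Criticality is read in these charts
through `Literature.Topology.FourManifolds.isMCriticalPt_iff_fderivWithin_writtenInExtChartAt_eq_zero` (`MorseProofs.lean`).

## References

* J. Milnor, *Morse theory*, Ann. of Math. Studies 51 (1963), §2 (nondegenerate critical points,
  index), §3 (Thm. 3.1, handles from critical points).
* J. Milnor, *Lectures on the h-cobordism theorem* (1965), Def. 3.1 (Morse functions on
  cobordisms / adapted to the boundary).
* A. Kosinski, *Differential Manifolds* (1993), VI.8 (handlebodies).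
-/

open scoped Manifold ContDiff Topology RealInnerProductSpace
open Set Function Filter

noncomputable section

namespace Literature.Topology.FourManifolds

/-- Local notation: `𝔼 n` is the model Euclidean space `EuclideanSpace ℝ (Fin n)`. -/
local notation "𝔼 " n:arg => EuclideanSpace ℝ (Fin n)

/-- Local notation: `𝕊 n` is the unit sphere in `EuclideanSpace ℝ (Fin (n + 1))`. -/
local notation "𝕊 " n:arg => (Metric.sphere (0 : EuclideanSpace ℝ (Fin (n + 1))) 1)

/-- Local notation: `𝔻 n` is the closed unit ball in `EuclideanSpace ℝ (Fin n)`. -/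
local notation "𝔻 " n:arg => (Metric.closedBall (0 : EuclideanSpace ℝ (Fin n)) 1)

attribute [local instance] fact_finrank_euclideanSpace_succ

variable (n : ℕ)

/-- The **height function** `x ↦ ‖x‖²` on the closed ball `𝔻ⁿ⁺¹`: the standard Morse function
presenting the ball as a single `0`-handle (Milnor, *Morse theory* (1963), §3).
[cite: Milnor1963, §3] -/
def ballHeight (x : 𝔻 (n + 1)) : ℝ := ‖(x : 𝔼 (n + 1))‖ ^ 2

/-- The **centre** of the closed ball `𝔻ⁿ⁺¹` (the origin), its unique critical point for the
height function. [folklore] -/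
def ballCenter : 𝔻 (n + 1) := ⟨0, by simp⟩

/-- Value of the height function. [folklore] -/
theorem ballHeight_apply (x : 𝔻 (n + 1)) : ballHeight n x = ‖(x : 𝔼 (n + 1))‖ ^ 2 := rfl

/-- The centre is the origin. [folklore] -/
@[simp]
theorem coe_ballCenter : ((ballCenter n : 𝔻 (n + 1)) : 𝔼 (n + 1)) = 0 := rfl

/-- The height function is smooth. [folklore] -/
theorem contMDiff_ballHeight : ContMDiff (𝓡∂ (n + 1)) 𝓘(ℝ, ℝ) ∞ (ballHeight n) :=
  ((contDiff_norm_sq ℝ (n := ∞)).contMDiff).comp (contMDiff_coe_closedBall (n := n))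

/-- The height function is differentiable. [folklore] -/
theorem mdifferentiableAt_ballHeight (x : 𝔻 (n + 1)) :
    MDifferentiableAt (𝓡∂ (n + 1)) 𝓘(ℝ, ℝ) (ballHeight n) x :=
  (contMDiff_ballHeight n x).mdifferentiableAt (by simp)

/-! ### The interior chart (chart at the centre) -/

/-- The extended chart at the centre is the extended interior chart. [folklore] -/
theorem extChartAt_ballCenter :
    extChartAt (𝓡∂ (n + 1)) (ballCenter n) = (closedBallInteriorChart n).extend (𝓡∂ (n + 1)) := by
  rw [extChartAt, closedBall_chartAt_of_norm_lt_one]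
  simp

/-- The extended chart at the centre is the translation by `2 • e₀`. [folklore] -/
theorem extChartAt_ballCenter_apply (y : 𝔻 (n + 1)) :
    extChartAt (𝓡∂ (n + 1)) (ballCenter n) y =
      (y : 𝔼 (n + 1)) + (2 : ℝ) • closedBallBaseVector n := by
  rw [extChartAt_ballCenter]
  rfl

/-- The source of the extended chart at the centre is the open unit ball. [folklore] -/
theorem extChartAt_ballCenter_source :
    (extChartAt (𝓡∂ (n + 1)) (ballCenter n)).source = {y : 𝔻 (n + 1) | ‖(y : 𝔼 (n + 1))‖ < 1} := by
  rw [extChartAt_ballCenter, OpenPartialHomeomorph.extend_source, closedBallInteriorChart_source]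

/-- A point of the model space with nonnegative first coordinate is fixed by `I.symm` followed by
the coercion. [folklore] -/
theorem modelWithCornersEuclideanHalfSpace_symm_apply {w : 𝔼 (n + 1)} (hw : 0 ≤ w 0) :
    (𝓡∂ (n + 1)).symm w = ⟨w, hw⟩ := by
  have h := (𝓡∂ (n + 1)).left_inv (x := (⟨w, hw⟩ : EuclideanHalfSpace (n + 1)))
  exact h

/-- Near the target of the interior chart the first coordinate is positive. [folklore] -/
theorem one_le_apply_zero_of_norm_sub_le {w : 𝔼 (n + 1)}
    (hw : ‖w - (2 : ℝ) • closedBallBaseVector n‖ ≤ 1) : 1 ≤ w 0 := by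
  have h1 : |(w - (2 : ℝ) • closedBallBaseVector n) 0| ≤ 1 :=
    le_trans (by simpa using (w - (2 : ℝ) • closedBallBaseVector n).norm_apply_le 0) hw
  have h2 : (w - (2 : ℝ) • closedBallBaseVector n) 0 = w 0 - 2 := by
    simp [PiLp.sub_apply, PiLp.smul_apply]
  rw [h2] at h1
  have := (abs_le.1 h1).1
  linarith

/-- The inverse extended chart at the centre is the translation by `-2 • e₀` on the unit ball
around `2 • e₀`. [folklore] -/
theorem extChartAt_ballCenter_symm_apply {w : 𝔼 (n + 1)}
    (hw : ‖w - (2 : ℝ) • closedBallBaseVector n‖ ≤ 1) :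
    (((extChartAt (𝓡∂ (n + 1)) (ballCenter n)).symm w : 𝔻 (n + 1)) : 𝔼 (n + 1)) =
      w - (2 : ℝ) • closedBallBaseVector n := by
  have hw0 : 0 ≤ w 0 := le_trans zero_le_one (one_le_apply_zero_of_norm_sub_le n hw)
  rw [extChartAt_ballCenter, OpenPartialHomeomorph.extend_coe_symm, comp_apply,
    modelWithCornersEuclideanHalfSpace_symm_apply n hw0]
  exact coe_closedBallInteriorChart_symm_apply (z := ⟨w, hw0⟩) hw

/-- In the chart at the centre the height function reads `w ↦ ‖w - 2 • e₀‖²` near every point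
of the chart target. [folklore] -/
theorem writtenInExtChartAt_ballHeight_ballCenter_eventuallyEq {w₀ : 𝔼 (n + 1)}
    (hw₀ : ‖w₀ - (2 : ℝ) • closedBallBaseVector n‖ < 1) :
    writtenInExtChartAt (𝓡∂ (n + 1)) 𝓘(ℝ, ℝ) (ballCenter n) (ballHeight n) =ᶠ[𝓝 w₀]
      fun w => ‖w - (2 : ℝ) • closedBallBaseVector n‖ ^ 2 := by
  have hopen : IsOpen {w : 𝔼 (n + 1) | ‖w - (2 : ℝ) • closedBallBaseVector n‖ < 1} :=
    isOpen_lt (by fun_prop) continuous_const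
  filter_upwards [hopen.mem_nhds hw₀] with w hw
  simp only [writtenInExtChartAt, extChartAt_model_space_eq_id, PartialEquiv.refl_coe, comp_apply,
    id_eq, ballHeight_apply]
  rw [extChartAt_ballCenter_symm_apply n (le_of_lt hw)]

/-- The open ball around `2 • e₀` lies in the interior of the half-space. [folklore] -/
theorem range_mem_nhds_of_norm_sub_lt {w : 𝔼 (n + 1)}
    (hw : ‖w - (2 : ℝ) • closedBallBaseVector n‖ < 1) : range (𝓡∂ (n + 1)) ∈ 𝓝 w := by
  rw [range_modelWithCornersEuclideanHalfSpace]
  have hopen : IsOpen {w : 𝔼 (n + 1) | ‖w - (2 : ℝ) • closedBallBaseVector n‖ < 1} :=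
    isOpen_lt (by fun_prop) continuous_const
  filter_upwards [hopen.mem_nhds hw] with w' hw'
  exact le_trans zero_le_one (one_le_apply_zero_of_norm_sub_le n hw'.le)

/-- **The derivative of the height function in the chart at the centre**: at the point `w` of the
chart target it is `2 ⟨w - 2 • e₀, ·⟩`. [folklore] -/
theorem fderivWithin_writtenInExtChartAt_ballHeight_ballCenter {w : 𝔼 (n + 1)}
    (hw : ‖w - (2 : ℝ) • closedBallBaseVector n‖ < 1) :
    fderivWithin ℝ (writtenInExtChartAt (𝓡∂ (n + 1)) 𝓘(ℝ, ℝ) (ballCenter n) (ballHeight n))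
      (range (𝓡∂ (n + 1))) w = 2 • innerSL ℝ (w - (2 : ℝ) • closedBallBaseVector n) := by
  rw [fderivWithin_of_mem_nhds (range_mem_nhds_of_norm_sub_lt n hw),
    (writtenInExtChartAt_ballHeight_ballCenter_eventuallyEq n hw).fderiv_eq]
  have h : HasFDerivAt (fun w : 𝔼 (n + 1) => ‖w - (2 : ℝ) • closedBallBaseVector n‖ ^ 2)
      (2 • (innerSL ℝ (w - (2 : ℝ) • closedBallBaseVector n)).comp
        (ContinuousLinearMap.id ℝ _)) w :=
    ((hasFDerivAt_id w).sub_const _).norm_sq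
  rw [h.fderiv]
  ext v
  simp

/-- **Critical points in the open ball**: a point `y` with `‖y‖ < 1` is critical for the height
function iff it is the centre. [folklore] -/
theorem isMCriticalPt_ballHeight_iff_of_norm_lt_one {y : 𝔻 (n + 1)} (hy : ‖(y : 𝔼 (n + 1))‖ < 1) :
    IsMCriticalPt (𝓡∂ (n + 1)) (ballHeight n) y ↔ y = ballCenter n := by
  have hsrc : y ∈ (extChartAt (𝓡∂ (n + 1)) (ballCenter n)).source := by
    rw [extChartAt_ballCenter_source]; exact hy
  rw [isMCriticalPt_iff_fderivWithin_writtenInExtChartAt_eq_zero hsrc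
      (mdifferentiableAt_ballHeight n y),
    extChartAt_ballCenter_apply,
    fderivWithin_writtenInExtChartAt_ballHeight_ballCenter n (by simpa using hy)]
  simp only [add_sub_cancel_right]
  constructor
  · intro h
    have h2 := congrArg (fun L : 𝔼 (n + 1) →L[ℝ] ℝ => L (y : 𝔼 (n + 1))) h
    have h3 : (y : 𝔼 (n + 1)) = 0 := by
      simpa [real_inner_self_eq_norm_sq] using h2
    exact Subtype.ext h3
  · rintro rfl
    simp

/-! ### The boundary charts -/

variable {n}

/-- In the chart at a boundary point `y` the height function reads `w ↦ (1 - w 0)²` on the part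
`{0 ≤ w 0 ≤ 1}` of the half-space. [folklore] -/
theorem writtenInExtChartAt_ballHeight_of_norm_eq_one {y : 𝔻 (n + 1)} (hy : ‖(y : 𝔼 (n + 1))‖ = 1)
    {w : 𝔼 (n + 1)} (hw0 : 0 ≤ w 0) (hw1 : w 0 ≤ 1) :
    writtenInExtChartAt (𝓡∂ (n + 1)) 𝓘(ℝ, ℝ) y (ballHeight n) w = (1 - w 0) ^ 2 := by
  simp only [writtenInExtChartAt, extChartAt_model_space_eq_id, PartialEquiv.refl_coe, comp_apply,
    id_eq, ballHeight_apply]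
  rw [extChartAt, closedBall_chartAt_of_norm_eq_one hy, OpenPartialHomeomorph.extend_coe_symm,
    comp_apply, modelWithCornersEuclideanHalfSpace_symm_apply n hw0,
    coe_closedBallBoundaryChart_symm_apply _ (z := ⟨w, hw0⟩) hw1,
    norm_smul_coe_sphere (by linarith)]

/-- **Boundary points are regular** for the height function. [folklore] -/
theorem not_isMCriticalPt_ballHeight_of_norm_eq_one {y : 𝔻 (n + 1)} (hy : ‖(y : 𝔼 (n + 1))‖ = 1) :
    ¬ IsMCriticalPt (𝓡∂ (n + 1)) (ballHeight n) y := by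
  rw [isMCriticalPt_iff_fderivWithin_writtenInExtChartAt_eq_zero (mem_extChartAt_source y)
    (mdifferentiableAt_ballHeight n y)]
  set e : 𝔼 (n + 1) := extChartAt (𝓡∂ (n + 1)) y y with he
  have he0 : e 0 = 0 := by
    rw [he, extChartAt, closedBall_chartAt_of_norm_eq_one hy,
      closedBallBoundaryChart_extend_apply_zero,
      hy, sub_self]
  have h1 : HasFDerivAt (fun w : 𝔼 (n + 1) => 1 - w 0)
      (0 - (EuclideanSpace.proj 0 : 𝔼 (n + 1) →L[ℝ] ℝ)) e :=
    (hasFDerivAt_const (1 : ℝ) e).sub (EuclideanSpace.proj (𝕜 := ℝ) (0 : Fin (n + 1))).hasFDerivAt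
  have hr := h1.pow 2
  have hEq : writtenInExtChartAt (𝓡∂ (n + 1)) 𝓘(ℝ, ℝ) y (ballHeight n) =ᶠ[𝓝[range (𝓡∂ (n + 1))] e]
      fun w => (1 - w 0) ^ 2 := by
    have hopen : IsOpen {w : 𝔼 (n + 1) | w 0 < 1} := isOpen_lt (by fun_prop) continuous_const
    have hmem : e ∈ {w : 𝔼 (n + 1) | w 0 < 1} := by
      simp only [mem_setOf_eq, he0]; exact zero_lt_one
    filter_upwards [mem_nhdsWithin_of_mem_nhds (hopen.mem_nhds hmem), self_mem_nhdsWithin]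
      with w hw1 hwI
    have hw0 : 0 ≤ w 0 := by
      rw [range_modelWithCornersEuclideanHalfSpace] at hwI; exact hwI
    exact writtenInExtChartAt_ballHeight_of_norm_eq_one hy hw0 (le_of_lt hw1)
  have hpt : writtenInExtChartAt (𝓡∂ (n + 1)) 𝓘(ℝ, ℝ) y (ballHeight n) e =
      (fun w : 𝔼 (n + 1) => (1 - w 0) ^ 2) e :=
    writtenInExtChartAt_ballHeight_of_norm_eq_one hy (le_of_eq he0.symm)
      (by rw [he0]; exact zero_le_one)
  have hderiv := hr.hasFDerivWithinAt.congr_of_eventuallyEq hEq hpt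
  rw [hderiv.fderivWithin ((𝓡∂ (n + 1)).uniqueDiffOn _ ⟨_, rfl⟩)]
  intro h
  have h2 := congrArg (fun L : 𝔼 (n + 1) →L[ℝ] ℝ => L (EuclideanSpace.single 0 1)) h
  simp [he0] at h2

variable (n)

/-- **The critical set of the height function is the centre.** [folklore] -/
theorem isMCriticalPt_ballHeight_iff (y : 𝔻 (n + 1)) :
    IsMCriticalPt (𝓡∂ (n + 1)) (ballHeight n) y ↔ y = ballCenter n := by
  by_cases hy : ‖(y : 𝔼 (n + 1))‖ < 1
  · exact isMCriticalPt_ballHeight_iff_of_norm_lt_one n hy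
  · have hy1 : ‖(y : 𝔼 (n + 1))‖ = 1 := (mem_closedBall_zero_iff.1 y.2).antisymm (not_lt.1 hy)
    refine ⟨fun h => (not_isMCriticalPt_ballHeight_of_norm_eq_one hy1 h).elim, ?_⟩
    rintro rfl
    simp at hy1

/-! ### The Hessian at the centre -/

/-- Near `2 • e₀` the coordinate expression of the derivative of the height function in the chart
at the centre is `w ↦ 2 ⟨w - 2 • e₀, ·⟩`. [folklore] -/
theorem fderivWithin_writtenInExtChartAt_ballHeight_ballCenter_eventuallyEq :
    fderivWithin ℝ (writtenInExtChartAt (𝓡∂ (n + 1)) 𝓘(ℝ, ℝ) (ballCenter n) (ballHeight n))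
      (range (𝓡∂ (n + 1))) =ᶠ[𝓝 ((2 : ℝ) • closedBallBaseVector n)]
      fun w => 2 • innerSL ℝ (w - (2 : ℝ) • closedBallBaseVector n) := by
  have hopen : IsOpen {w : 𝔼 (n + 1) | ‖w - (2 : ℝ) • closedBallBaseVector n‖ < 1} :=
    isOpen_lt (by fun_prop) continuous_const
  have hmem : (2 : ℝ) • closedBallBaseVector n ∈
      {w : 𝔼 (n + 1) | ‖w - (2 : ℝ) • closedBallBaseVector n‖ < 1} := by simp
  filter_upwards [hopen.mem_nhds hmem] with w hw
  exact fderivWithin_writtenInExtChartAt_ballHeight_ballCenter n hw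

/-- **The Hessian of the height function at the centre is `2 ⟨·, ·⟩`.** [folklore] -/
theorem mhessian_ballHeight_ballCenter (v w : 𝔼 (n + 1)) :
    mhessian (𝓡∂ (n + 1)) (ballHeight n) (ballCenter n) v w = 2 * ⟪v, w⟫ := by
  have hc : extChartAt (𝓡∂ (n + 1)) (ballCenter n) (ballCenter n) =
      (2 : ℝ) • closedBallBaseVector n := by
    rw [extChartAt_ballCenter_apply, coe_ballCenter, zero_add]
  have hG : HasFDerivAt (fun w : 𝔼 (n + 1) => 2 • innerSL ℝ (w - (2 : ℝ) • closedBallBaseVector n))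
      (2 • (innerSL ℝ : 𝔼 (n + 1) →L[ℝ] 𝔼 (n + 1) →L[ℝ] ℝ).comp (ContinuousLinearMap.id ℝ _))
      ((2 : ℝ) • closedBallBaseVector n) :=
    ((innerSL ℝ : 𝔼 (n + 1) →L[ℝ] 𝔼 (n + 1) →L[ℝ] ℝ).hasFDerivAt.comp _
      ((hasFDerivAt_id _).sub_const _)).const_smul 2
  have key : fderivWithin ℝ (fderivWithin ℝ
      (writtenInExtChartAt (𝓡∂ (n + 1)) 𝓘(ℝ, ℝ) (ballCenter n) (ballHeight n)) (range (𝓡∂ (n + 1))))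
      (range (𝓡∂ (n + 1))) (extChartAt (𝓡∂ (n + 1)) (ballCenter n) (ballCenter n)) =
      2 • (innerSL ℝ : 𝔼 (n + 1) →L[ℝ] 𝔼 (n + 1) →L[ℝ] ℝ).comp (ContinuousLinearMap.id ℝ _) := by
    rw [hc, fderivWithin_of_mem_nhds (range_mem_nhds_of_norm_sub_lt n (by simp)),
      (fderivWithin_writtenInExtChartAt_ballHeight_ballCenter_eventuallyEq n).fderiv_eq, hG.fderiv]
  change (fderivWithin ℝ (fderivWithin ℝ
      (writtenInExtChartAt (𝓡∂ (n + 1)) 𝓘(ℝ, ℝ) (ballCenter n) (ballHeight n)) (range (𝓡∂ (n + 1))))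
      (range (𝓡∂ (n + 1))) (extChartAt (𝓡∂ (n + 1)) (ballCenter n) (ballCenter n)) v) w = _
  rw [key]
  simp only [FunLike.coe_smul, Pi.smul_apply, ContinuousLinearMap.comp_apply,
    ContinuousLinearMap.id_apply, nsmul_eq_mul, Nat.cast_ofNat]
  rfl

/-- The Hessian of the height function at the centre is nondegenerate. [folklore] -/
theorem nondegenerate_mhessian_ballHeight_ballCenter :
    (mhessian (𝓡∂ (n + 1)) (ballHeight n) (ballCenter n)).Nondegenerate := by
  refine ⟨fun v hv => ?_, fun v hv => ?_⟩
  · have h := hv v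
    rw [mhessian_ballHeight_ballCenter] at h
    have h' : ⟪v, v⟫ = 0 := by linarith
    exact inner_self_eq_zero.mp h'
  · have h := hv v
    rw [mhessian_ballHeight_ballCenter] at h
    have h' : ⟪v, v⟫ = 0 := by linarith
    exact inner_self_eq_zero.mp h'

/-- **The centre is a critical point of index `0`** (the Hessian `2 ⟨·, ·⟩` is positive definite,
so no nonzero subspace is negative definite). [folklore] -/
theorem morseIndex_ballHeight_ballCenter :
    morseIndex (𝓡∂ (n + 1)) (ballHeight n) (ballCenter n) = 0 := by
  unfold morseIndex
  set Q := (mhessian (𝓡∂ (n + 1)) (ballHeight n) (ballCenter n)).toQuadraticMap with hQ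
  have hQv : ∀ v, Q v = 2 * ‖v‖ ^ 2 := fun v => by
    rw [hQ, LinearMap.BilinMap.toQuadraticMap_apply, mhessian_ballHeight_ballCenter,
      real_inner_self_eq_norm_sq]
  obtain ⟨V, hV, hpos⟩ := exists_finrank_eq_sigNeg_and_negDef Q
  rw [← hV]
  by_contra hne
  obtain ⟨x, hx⟩ :=
    (Module.finrank_pos_iff_exists_ne_zero (R := ℝ) (M := V)).mp (Nat.pos_of_ne_zero hne)
  have h1 := hpos x hx
  have h2 : ((-Q).restrict V) x = -(Q (x : 𝔼 (n + 1))) := rfl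
  rw [h2, hQv] at h1
  have h3 : 0 ≤ 2 * ‖(x : 𝔼 (n + 1))‖ ^ 2 := by positivity
  linarith

/-! ### The height function is a Morse function adapted to the boundary -/

/-- **The height function is a Morse function** on the closed ball. [folklore] -/
theorem isMorse_ballHeight : IsMorse (𝓡∂ (n + 1)) (ballHeight n) := by
  refine ⟨contMDiff_ballHeight n, fun x hx => ?_⟩
  obtain rfl := (isMCriticalPt_ballHeight_iff n x).1 hx
  exact nondegenerate_mhessian_ballHeight_ballCenter n

/-- **The height function is adapted to the boundary**: it is `1` and regular on `∂𝔻ⁿ⁺¹ = 𝕊ⁿ`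
and `< 1` inside. [folklore] -/
theorem isMorseAdapted_ballHeight : IsMorseAdapted (𝓡∂ (n + 1)) (ballHeight n) := by
  refine ⟨isMorse_ballHeight n, fun x hx => ?_, fun x hx => ?_⟩
  · rw [boundary_closedBall] at hx
    have hx1 : ‖(x : 𝔼 (n + 1))‖ = 1 := hx
    exact ⟨by rw [ballHeight_apply, hx1, one_pow], not_isMCriticalPt_ballHeight_of_norm_eq_one hx1⟩
  · rw [interior_closedBall] at hx
    have hx1 : ‖(x : 𝔼 (n + 1))‖ < 1 := hx
    rw [ballHeight_apply]
    nlinarith [norm_nonneg (x : 𝔼 (n + 1))]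

/-- The critical points of index `k` of the height function: the centre for `k = 0`, none
otherwise. [folklore] -/
theorem criticalSetOfIndex_ballHeight (k : ℕ) :
    criticalSetOfIndex (𝓡∂ (n + 1)) (ballHeight n) k = if k = 0 then {ballCenter n} else ∅ := by
  ext x
  rw [mem_criticalSetOfIndex, isMCriticalPt_ballHeight_iff]
  constructor
  · rintro ⟨rfl, hk⟩
    rw [morseIndex_ballHeight_ballCenter] at hk
    subst hk
    simp
  · intro h
    split_ifs at h with hk
    · subst hk
      rw [mem_singleton_iff] at h
      subst h
      exact ⟨rfl, morseIndex_ballHeight_ballCenter n⟩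
    · exact h.elim

/-- **The closed ball `𝔻ⁿ⁺¹` is a `0`-handle**: it has a handle decomposition with exactly one
handle of index `0` and no other handles (`Literature.HasHandleDecomposition n 𝔻ⁿ⁺¹ (handleCount 1 0)`),
presented by the Morse function `‖x‖²` (Milnor, *Morse theory* (1963), §3, Thm. 3.1 and the
example of the disc; Kosinski (1993), VI.8). [cite: Milnor1963, §3] -/
theorem hasHandleDecomposition_closedBall :
    HasHandleDecomposition n (𝔻 (n + 1)) (handleCount 1 0) := by
  refine ⟨ballHeight n, isMorseAdapted_ballHeight n, fun k => ?_⟩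
  rw [criticalSetOfIndex_ballHeight]
  rcases Nat.eq_zero_or_pos k with rfl | hk
  · simp
  · rw [if_neg hk.ne']
    rcases k with _ | k
    · exact absurd hk (lt_irrefl 0)
    · rcases k with _ | k
      · simp
      · rw [handleCount_of_two_le 1 0 (by omega), ncard_empty]

/-- The closed ball is a handlebody with handles of index `≤ 0` (a single `0`-handle).
[cite: Milnor1963, §3] -/
theorem isHandlebodyOfIndexLE_closedBall (k : ℕ) : IsHandlebodyOfIndexLE n k (𝔻 (n + 1)) := by
  refine ⟨ballHeight n, isMorseAdapted_ballHeight n, fun z hz => ?_⟩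
  obtain rfl := (isMCriticalPt_ballHeight_iff n z).1 hz
  rw [morseIndex_ballHeight_ballCenter]
  exact Nat.zero_le k

/-! ### Connectedness and orientability of the closed ball -/

/-- The closed ball is connected (it is convex and nonempty). [folklore] -/
theorem connectedSpace_closedBall : ConnectedSpace (𝔻 (n + 1)) :=
  isConnected_iff_connectedSpace.1
    ((convex_closedBall (0 : 𝔼 (n + 1)) 1).isPathConnected ⟨0, by simp⟩).isConnected

/-- **The closed ball is orientable** (as a manifold with boundary): it is contractible
(Mathlib `Metric.contractibleSpace_closedBall`), hence simply connected, and simply connected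
manifolds are orientable (`Literature.Topology.FourManifolds.isOrientable_of_simplyConnectedSpace_holds`; Lee (2013),
Thm. 15.43). [folklore] -/
theorem isOrientable_closedBall : IsOrientable (𝓡∂ (n + 1)) (𝔻 (n + 1)) := by
  haveI : ContractibleSpace (𝔻 (n + 1)) := Metric.contractibleSpace_closedBall zero_le_one
  exact isOrientable_of_simplyConnectedSpace_holds

end Literature.Topology.FourManifolds
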